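import Mathlib
import HarnessLib

/-!
# Crux `DigitPolyUniformity` (stmt-QuantumAdvantage-1392), line `Sketch`, cycle 7 — Stub KMT-count-AP

Counting the members of a residue class in an interval: `#{n ∈ [u, v) : n % q = a} ≤ (v − u)/q + 1`
(truncated subtraction and division in `ℕ`, then cast to `ℝ`).  The map `n ↦ (n - u) / q` is injective
on the residue class inside `[u, v)` (two class members with the same quotient differ by less than `q`)
and takes values in `[0, (v - u)/q]`; for `q = 0` the class `{n : n % 0 = a} = {a}` has at most one
element and the bound reads `≤ 0 + 1`.
-/

noncomputable section

namespace Summit.QuantumAdvantage.DigitPolyUniformity.SketchLAR.KMT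

open Finset

/-- Two naturals `n, n' ≥ u` that are congruent modulo `q` and whose offsets `n - u`, `n' - u` have the
same quotient by `q` are equal (also for `q = 0`, where `n % 0 = n`). [folklore] -/
theorem countAP_eq_of_mod_eq_of_div_eq {q u n n' : ℕ} (hn : u ≤ n) (hn' : u ≤ n')
    (hmod : n % q = n' % q) (hdiv : (n - u) / q = (n' - u) / q) : n = n' := by
  rcases Nat.eq_zero_or_pos q with rfl | hq
  · simpa using hmod
  have h1 := Nat.div_add_mod (n - u) q
  have h2 := Nat.div_add_mod (n' - u) q
  have r1 := Nat.mod_lt (n - u) hq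
  have r2 := Nat.mod_lt (n' - u) hq
  rw [hdiv] at h1
  rcases le_total n n' with hle | hle
  · have hlt : n' - n < q := by omega
    have e1 := Nat.sub_mod_eq_zero_of_mod_eq hmod.symm
    have e2 := Nat.mod_eq_of_lt hlt
    omega
  · have hlt : n - n' < q := by omega
    have e1 := Nat.sub_mod_eq_zero_of_mod_eq hmod
    have e2 := Nat.mod_eq_of_lt hlt
    omega

/-- Natural-number form of the count: `#{n ∈ [u, v) : n % q = a} ≤ (v − u)/q + 1`. [folklore] -/
theorem countAP_card_filter_mod_le (u v q a : ℕ) :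
    ((Ico u v).filter (fun n => n % q = a)).card ≤ (v - u) / q + 1 := by
  calc ((Ico u v).filter (fun n => n % q = a)).card
      ≤ (range ((v - u) / q + 1)).card := by
        refine Finset.card_le_card_of_injOn (fun n => (n - u) / q) ?_ ?_
        · intro n hn
          simp only [Finset.coe_filter, Set.mem_setOf_eq, Finset.mem_Ico] at hn
          simp only [Finset.mem_coe, Finset.mem_range]
          exact Nat.lt_succ_of_le (Nat.div_le_div_right (by omega))
        · intro n hn n' hn' heq
          simp only [Finset.coe_filter, Set.mem_setOf_eq, Finset.mem_Ico] at hn hn'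
          exact countAP_eq_of_mod_eq_of_div_eq hn.1.1 hn'.1.1 (hn.2.trans hn'.2.symm) heq
    _ = (v - u) / q + 1 := Finset.card_range _

/-- **Stub KMT-A (members of a residue class in an interval).** `#{n ∈ [u, v) : n % q = a} ≤ (v − u)/q + 1`
(truncated subtraction; for `q = 0` the class is a single point). [folklore] -/
theorem stub_kmt_count_AP (u v q a : ℕ) :
    ((((Ico u v).filter (fun n => n % q = a)).card : ℕ) : ℝ) ≤ ((v - u : ℕ) : ℝ) / q + 1 := by
  calc ((((Ico u v).filter (fun n => n % q = a)).card : ℕ) : ℝ)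
      ≤ (((v - u) / q + 1 : ℕ) : ℝ) := by exact_mod_cast countAP_card_filter_mod_le u v q a
    _ = (((v - u) / q : ℕ) : ℝ) + 1 := by push_cast; ring
    _ ≤ ((v - u : ℕ) : ℝ) / q + 1 := by gcongr; exact Nat.cast_div_le

end Summit.QuantumAdvantage.DigitPolyUniformity.SketchLAR.KMT
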